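import Summits.QuantumFields.QCD.Theses.NestedDissectionSea

/-!
# `DiluteOfCoercive` — the hinge projects onto the tier-deciding crux

Route `NestedDissectionSea` (sub-problem QCD), support item stmt-QuantumFields-11276.

`CoerciveSea` (the hinge, stmt-QuantumFields-13901) shares its `∃ reg … ∃ R` prefix with
`NegativeCellsDilute` (stmt-QuantumFields-13900), and its clauses (ii) windowed local dilution and
(iii) parity pin are clauses (a) and (b) of `NegativeCellsDilute` verbatim; clause (i), the separator
Wegner law, is simply dropped. The proof is pure logic: unpack the prefix, forget (i), repack.
Consequence recorded by the route: refuting `NegativeCellsDilute` refutes `CoerciveSea`.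
-/

namespace Summit.QuantumFields.QCD.Theorems

open Summit.QuantumFields.QCD.Theses.NestedDissectionSea

/-- **DiluteOfCoercive** (route `NestedDissectionSea`, item stmt-QuantumFields-11276):
`CoerciveSea → NegativeCellsDilute`. The hinge's clauses (ii)–(iii) are the crux verbatim, so the
implication is the projection forgetting clause (i) (the separator Wegner law). -/
theorem diluteOfCoercive_proof :
    Summit.QuantumFields.QCD.Theses.NestedDissectionSea.DiluteOfCoercive := by
  unfold DiluteOfCoercive
  intro hSea Nf hNf
  obtain ⟨reg, hms, has, M₀, hM₀, b₀, hb₀, ℓ, hℓ, hbody⟩ := hSea Nf hNf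
  refine ⟨reg, hms, has, M₀, hM₀, b₀, hb₀, ℓ, hℓ, fun m hm => ?_⟩
  obtain ⟨R, hR, _, hii, hiii⟩ := hbody m hm
  exact ⟨R, hR, hii, hiii⟩

end Summit.QuantumFields.QCD.Theorems
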